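import Mathlib
import Summits.Ventures.PercRepro2.CoinChainTauLayer
import Summits.Ventures.PercRepro2.CoinChainXASigns

/-!
# The layer-cake bounds for the gate functional, centred at ANY Holley-dominated law
(blind cell PercRepro2, night-2 g26; proofs/NIGHT2-DARC.md §67.10)

For an OR-tail pair `(G, G')` with entries `ent` (`G'` log-supermodular, Holley-above `G` from every
cluster meeting `ent`), the τ-layer-cake bound `tau_layer_bound` is EQUIVALENT to the clean
inequality
  `N_∅ʸ · (Λ g₁ − Λ₁ g₀) ≤ N_∅ · (Λ g₁₂ − Λ₁ g₂)`,   i.e.   `∑ G' (Λ x − Λ₁)(N_∅ y − N_∅ʸ) ≥ 0`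
(`tau_cake_of_holley`): the gate `G'` has nonnegative "covariance" between `x` centred at the
`G`-mean and `y` centred at the ideal mean `N_∅ʸ / N_∅`.  Since `∑ G' (N_∅ y − N_∅ʸ) ≥ 0`, the
bound is monotone in the centring mean: the larger the `x`-mean of the comparison law, the
sharper it is.  In the AND-switch chain every law `ν · chainMix ρ c d`, `ν · chainMix ρ c d'`
(`0 ≤ ρ ≤ 1`) is Holley-below the world-1 gate `G¹` from the entries `ent ∪ ent'` and agrees with
it on the entry-free ideal, so all of them are admissible centrings (CoinChainXACakeLaws).

`chain_XA'_of_cake`: (XA′) `Cross ≤ a0·U001` from such a cake at a law with moments `(l0, l1)`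
and the cleared moment condition `hcond` (pure algebra, `xa_cake_alg`: the identity
`m·l0·U001 = a0²·C + a0(a0 l1 − a1 l0)(m g₂ − mʸ g₀) + (a0 mʸ − a2 m) l0 (a0 g₁ − a1 g₀)`);
`chain_XA'_of_cake_y` is the mirror.  The crude bounds of CoinChainXACrude are the cases
`(l0, l1) = (a0, a1)` (τ) and, through FKG, `(g0, g1)`.
-/

namespace Summit.Ventures.PercRepro2.Coin

open Classical

section CakeAbstract

variable {V : Type*} [DecidableEq V] {R : Type*} [Field R] [LinearOrder R] [IsStrictOrderedRing R]

/-- **THE τ-LAYER CAKE IN CLEAN FORM**: for an OR-tail pair `(G, G')` with entries `ent` and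
`Λ = ∑ G > 0`, `N_∅ʸ (Λ g₁ − Λ₁ g₀) ≤ N_∅ (Λ g₁₂ − Λ₁ g₂)`. -/
theorem tau_cake_of_holley (U ent : Finset V) (G G' x y : Finset V → R)
    (hG : ∀ W, 0 ≤ G W) (hG' : ∀ W, 0 ≤ G' W)
    (hx0 : ∀ W, 0 ≤ x W) (hy0 : ∀ W, 0 ≤ y W)
    (hxm : ∀ s t, x s ≤ x (s ∪ t)) (hym : ∀ s t, y s ≤ y (s ∪ t))
    (wMM : ∀ s ⊆ U, ∀ t ⊆ U, G' s * G' t ≤ G' (s ∩ t) * G' (s ∪ t))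
    (wML : ∀ s ⊆ U, ∀ t ⊆ U, (∃ r ∈ ent, r ∈ s) → G' s * G t ≤ G (s ∩ t) * G' (s ∪ t))
    (hΛ : 0 < ∑ W ∈ U.powerset, G W) :
    (∑ W ∈ U.powerset.filter (fun W => W ∩ ent = ∅), G' W * y W) *
        ((∑ W ∈ U.powerset, G W) * (∑ W ∈ U.powerset, G' W * x W) -
          (∑ W ∈ U.powerset, G W * x W) * (∑ W ∈ U.powerset, G' W)) ≤
      (∑ W ∈ U.powerset.filter (fun W => W ∩ ent = ∅), G' W) *
        ((∑ W ∈ U.powerset, G W) * (∑ W ∈ U.powerset, G' W * (x W * y W)) -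
          (∑ W ∈ U.powerset, G W * x W) * (∑ W ∈ U.powerset, G' W * y W)) := by
  have hTL := tau_layer_bound U ent G G' x y hG hG' hx0 hy0 hxm hym wMM wML
  have hSG := centred_expand_sc G' x y U.powerset (∑ W ∈ U.powerset, G W)
    (∑ W ∈ U.powerset, G W * x W) (∑ W ∈ U.powerset, G W * y W)
  rw [hSG] at hTL
  -- the killed `x`-shift `∑ (G − G')(Λx − Λ₁) = Λ₁ g₀ − Λ g₁`
  have hK : (∑ W ∈ U.powerset, (G W - G' W) *
      ((∑ W ∈ U.powerset, G W) * x W - (∑ W ∈ U.powerset, G W * x W))) =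
      (∑ W ∈ U.powerset, G W * x W) * (∑ W ∈ U.powerset, G' W) -
        (∑ W ∈ U.powerset, G W) * (∑ W ∈ U.powerset, G' W * x W) := by
    rw [Finset.sum_congr rfl (fun W _ => show
      (G W - G' W) * ((∑ W ∈ U.powerset, G W) * x W - (∑ W ∈ U.powerset, G W * x W)) =
      ((∑ W ∈ U.powerset, G W) * (G W * x W) - (∑ W ∈ U.powerset, G W * x W) * G W)
      - ((∑ W ∈ U.powerset, G W) * (G' W * x W) - (∑ W ∈ U.powerset, G W * x W) * G' W)
      from by ring)]
    rw [Finset.sum_sub_distrib, Finset.sum_sub_distrib, Finset.sum_sub_distrib,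
      ← Finset.mul_sum, ← Finset.mul_sum, ← Finset.mul_sum, ← Finset.mul_sum]
    ring
  rw [hK] at hTL
  -- `RHS − LHS = Λ · C`
  have key : 0 ≤ (∑ W ∈ U.powerset, G W) *
      ((∑ W ∈ U.powerset.filter (fun W => W ∩ ent = ∅), G' W) *
        ((∑ W ∈ U.powerset, G W) * (∑ W ∈ U.powerset, G' W * (x W * y W)) -
          (∑ W ∈ U.powerset, G W * x W) * (∑ W ∈ U.powerset, G' W * y W)) -
      (∑ W ∈ U.powerset.filter (fun W => W ∩ ent = ∅), G' W * y W) *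
        ((∑ W ∈ U.powerset, G W) * (∑ W ∈ U.powerset, G' W * x W) -
          (∑ W ∈ U.powerset, G W * x W) * (∑ W ∈ U.powerset, G' W))) := by
    nlinarith [hTL]
  have := nonneg_of_mul_nonneg_right key hΛ
  linarith

end CakeAbstract

section CakeAlg

variable {R : Type*} [Field R] [LinearOrder R] [IsStrictOrderedRing R]

/-- The algebra behind `chain_XA'_of_cake`: with `C := m (l0 g₁₂ − l1 g₂) − mʸ (l0 g₁ − l1 g₀) ≥ 0`,
`m·l0·U001 = a0²·C + a0 (a0 l1 − a1 l0)(m g₂ − mʸ g₀) + (a0 mʸ − a2 m) l0 (a0 g₁ − a1 g₀)`. -/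
theorem xa_cake_alg (m my a0 a1 a2 l0 l1 g0 g1 g2 g12 Cr : R) (hm : 0 < m) (hl0 : 0 < l0)
    (ha0 : 0 ≤ a0) (hC : my * (l0 * g1 - l1 * g0) ≤ m * (l0 * g12 - l1 * g2))
    (hcond : m * l0 * Cr ≤ a0 * (a0 * ((a0 * l1 - a1 * l0) * (m * g2 - my * g0)) +
      (a0 * my - a2 * m) * l0 * (a0 * g1 - a1 * g0))) :
    Cr ≤ a0 * (a0 * a0 * g12 - a0 * a2 * g1 - a0 * a1 * g2 + a1 * a2 * g0) := by
  have hid : m * l0 * (a0 * (a0 * a0 * g12 - a0 * a2 * g1 - a0 * a1 * g2 + a1 * a2 * g0)) =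
      a0 * (a0 * a0 * (m * (l0 * g12 - l1 * g2) - my * (l0 * g1 - l1 * g0)) +
        a0 * ((a0 * l1 - a1 * l0) * (m * g2 - my * g0)) +
        (a0 * my - a2 * m) * l0 * (a0 * g1 - a1 * g0)) := by ring
  have hC' : 0 ≤ a0 * (a0 * a0 * (m * (l0 * g12 - l1 * g2) - my * (l0 * g1 - l1 * g0))) :=
    mul_nonneg ha0 (mul_nonneg (mul_nonneg ha0 ha0) (by linarith))
  have hml : 0 < m * l0 := mul_pos hm hl0
  have h2 : m * l0 * Cr ≤ m * l0 * (a0 * (a0 * a0 * g12 - a0 * a2 * g1 - a0 * a1 * g2 + a1 * a2 * g0)) := by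
    rw [hid]; nlinarith [hcond, hC']
  exact le_of_mul_le_mul_left h2 hml

end CakeAlg

section CakeChain

variable {V : Type*} [DecidableEq V] {R : Type*} [Field R] [LinearOrder R] [IsStrictOrderedRing R]

/-- **(XA′) FROM A τ-LAYER CAKE CENTRED AT ANY ADMISSIBLE LAW** with moments `(l0, l1)` (`hC` = the
cake, `hcond` = the cleared moment condition). -/
theorem chain_XA'_of_cake (U ent ent' : Finset V) (ν c d d' : Finset V → R)
    (hν0 : ∀ W, 0 ≤ ν W) (hc0 : ∀ W, 0 ≤ c W) (hd0 : ∀ W, 0 ≤ d W)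
    (x y : Finset V → R)
    (hmI : 0 < ∑ W ∈ U.powerset.filter (fun W => ¬ ∃ r ∈ ent ∪ ent', r ∈ W), ν W * c W)
    (l0 l1 : R) (hl0 : 0 < l0)
    (hC : (∑ W ∈ U.powerset.filter (fun W => ¬ ∃ r ∈ ent ∪ ent', r ∈ W), ν W * c W * y W) * (l0 * (∑ W ∈ U.powerset, ν W * chainMix ent ent' 1 c d' W * x W) - l1 * (∑ W ∈ U.powerset, ν W * chainMix ent ent' 1 c d' W)) ≤
      (∑ W ∈ U.powerset.filter (fun W => ¬ ∃ r ∈ ent ∪ ent', r ∈ W), ν W * c W) * (l0 * (∑ W ∈ U.powerset, ν W * chainMix ent ent' 1 c d' W * (x W * y W)) - l1 * (∑ W ∈ U.powerset, ν W * chainMix ent ent' 1 c d' W * y W)))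
    (hcond : (∑ W ∈ U.powerset.filter (fun W => ¬ ∃ r ∈ ent ∪ ent', r ∈ W), ν W * c W) * l0 *
      ((((∑ W ∈ U.powerset, ν W * chainMix ent ent' 0 c d W) * (∑ W ∈ U.powerset, ν W * chainMix ent ent' 1 c d W * x W) - (∑ W ∈ U.powerset, ν W * chainMix ent ent' 0 c d W * x W) * (∑ W ∈ U.powerset, ν W * chainMix ent ent' 1 c d W)) *
          ((∑ W ∈ U.powerset, ν W * chainMix ent ent' 0 c d W) * (∑ W ∈ U.powerset, ν W * chainMix ent ent' 0 c d' W * y W) - (∑ W ∈ U.powerset, ν W * chainMix ent ent' 0 c d W * y W) * (∑ W ∈ U.powerset, ν W * chainMix ent ent' 0 c d' W))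
        + ((∑ W ∈ U.powerset, ν W * chainMix ent ent' 0 c d W) * (∑ W ∈ U.powerset, ν W * chainMix ent ent' 1 c d W * y W) - (∑ W ∈ U.powerset, ν W * chainMix ent ent' 0 c d W * y W) * (∑ W ∈ U.powerset, ν W * chainMix ent ent' 1 c d W)) *
          ((∑ W ∈ U.powerset, ν W * chainMix ent ent' 0 c d W) * (∑ W ∈ U.powerset, ν W * chainMix ent ent' 0 c d' W * x W) - (∑ W ∈ U.powerset, ν W * chainMix ent ent' 0 c d W * x W) * (∑ W ∈ U.powerset, ν W * chainMix ent ent' 0 c d' W)))) ≤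
      (∑ W ∈ U.powerset, ν W * chainMix ent ent' 0 c d W) * ((∑ W ∈ U.powerset, ν W * chainMix ent ent' 0 c d W) * (((∑ W ∈ U.powerset, ν W * chainMix ent ent' 0 c d W) * l1 - (∑ W ∈ U.powerset, ν W * chainMix ent ent' 0 c d W * x W) * l0) * ((∑ W ∈ U.powerset.filter (fun W => ¬ ∃ r ∈ ent ∪ ent', r ∈ W), ν W * c W) * (∑ W ∈ U.powerset, ν W * chainMix ent ent' 1 c d' W * y W) - (∑ W ∈ U.powerset.filter (fun W => ¬ ∃ r ∈ ent ∪ ent', r ∈ W), ν W * c W * y W) * (∑ W ∈ U.powerset, ν W * chainMix ent ent' 1 c d' W)))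
        + ((∑ W ∈ U.powerset, ν W * chainMix ent ent' 0 c d W) * (∑ W ∈ U.powerset.filter (fun W => ¬ ∃ r ∈ ent ∪ ent', r ∈ W), ν W * c W * y W) - (∑ W ∈ U.powerset, ν W * chainMix ent ent' 0 c d W * y W) * (∑ W ∈ U.powerset.filter (fun W => ¬ ∃ r ∈ ent ∪ ent', r ∈ W), ν W * c W)) * l0 * ((∑ W ∈ U.powerset, ν W * chainMix ent ent' 0 c d W) * (∑ W ∈ U.powerset, ν W * chainMix ent ent' 1 c d' W * x W) - (∑ W ∈ U.powerset, ν W * chainMix ent ent' 0 c d W * x W) * (∑ W ∈ U.powerset, ν W * chainMix ent ent' 1 c d' W))))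
    :
    (((∑ W ∈ U.powerset, ν W * chainMix ent ent' 0 c d W) * (∑ W ∈ U.powerset, ν W * chainMix ent ent' 1 c d W * x W) - (∑ W ∈ U.powerset, ν W * chainMix ent ent' 0 c d W * x W) * (∑ W ∈ U.powerset, ν W * chainMix ent ent' 1 c d W)) *
          ((∑ W ∈ U.powerset, ν W * chainMix ent ent' 0 c d W) * (∑ W ∈ U.powerset, ν W * chainMix ent ent' 0 c d' W * y W) - (∑ W ∈ U.powerset, ν W * chainMix ent ent' 0 c d W * y W) * (∑ W ∈ U.powerset, ν W * chainMix ent ent' 0 c d' W))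
        + ((∑ W ∈ U.powerset, ν W * chainMix ent ent' 0 c d W) * (∑ W ∈ U.powerset, ν W * chainMix ent ent' 1 c d W * y W) - (∑ W ∈ U.powerset, ν W * chainMix ent ent' 0 c d W * y W) * (∑ W ∈ U.powerset, ν W * chainMix ent ent' 1 c d W)) *
          ((∑ W ∈ U.powerset, ν W * chainMix ent ent' 0 c d W) * (∑ W ∈ U.powerset, ν W * chainMix ent ent' 0 c d' W * x W) - (∑ W ∈ U.powerset, ν W * chainMix ent ent' 0 c d W * x W) * (∑ W ∈ U.powerset, ν W * chainMix ent ent' 0 c d' W))) ≤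
        (∑ W ∈ U.powerset, ν W * chainMix ent ent' 0 c d W) * ((∑ W ∈ U.powerset, ν W * chainMix ent ent' 0 c d W) * (∑ W ∈ U.powerset, ν W * chainMix ent ent' 0 c d W) * (∑ W ∈ U.powerset, ν W * chainMix ent ent' 1 c d' W * (x W * y W))
          - (∑ W ∈ U.powerset, ν W * chainMix ent ent' 0 c d W) * (∑ W ∈ U.powerset, ν W * chainMix ent ent' 0 c d W * y W) * (∑ W ∈ U.powerset, ν W * chainMix ent ent' 1 c d' W * x W)
          - (∑ W ∈ U.powerset, ν W * chainMix ent ent' 0 c d W) * (∑ W ∈ U.powerset, ν W * chainMix ent ent' 0 c d W * x W) * (∑ W ∈ U.powerset, ν W * chainMix ent ent' 1 c d' W * y W)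
          + (∑ W ∈ U.powerset, ν W * chainMix ent ent' 0 c d W * x W) * (∑ W ∈ U.powerset, ν W * chainMix ent ent' 0 c d W * y W) * (∑ W ∈ U.powerset, ν W * chainMix ent ent' 1 c d' W)) := by
  have hm0 : ∀ W, 0 ≤ chainMix ent ent' 0 c d W := chainMix_nonneg ent ent' le_rfl zero_le_one hc0 hd0
  have ha0 : 0 ≤ ∑ W ∈ U.powerset, ν W * chainMix ent ent' 0 c d W :=
    Finset.sum_nonneg fun W _ => mul_nonneg (hν0 W) (hm0 W)
  exact xa_cake_alg _ _ _ _ _ _ _ _ _ _ _ _ hmI hl0 ha0 hC hcond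

/-- **(XA′) FROM A σ-LAYER CAKE** (the mirror of `chain_XA'_of_cake`, moments `(l0, l2)`). -/
theorem chain_XA'_of_cake_y (U ent ent' : Finset V) (ν c d d' : Finset V → R)
    (hν0 : ∀ W, 0 ≤ ν W) (hc0 : ∀ W, 0 ≤ c W) (hd0 : ∀ W, 0 ≤ d W)
    (x y : Finset V → R)
    (hmI : 0 < ∑ W ∈ U.powerset.filter (fun W => ¬ ∃ r ∈ ent ∪ ent', r ∈ W), ν W * c W)
    (l0 l2 : R) (hl0 : 0 < l0)
    (hC : (∑ W ∈ U.powerset.filter (fun W => ¬ ∃ r ∈ ent ∪ ent', r ∈ W), ν W * c W * x W) * (l0 * (∑ W ∈ U.powerset, ν W * chainMix ent ent' 1 c d' W * y W) - l2 * (∑ W ∈ U.powerset, ν W * chainMix ent ent' 1 c d' W)) ≤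
      (∑ W ∈ U.powerset.filter (fun W => ¬ ∃ r ∈ ent ∪ ent', r ∈ W), ν W * c W) * (l0 * (∑ W ∈ U.powerset, ν W * chainMix ent ent' 1 c d' W * (x W * y W)) - l2 * (∑ W ∈ U.powerset, ν W * chainMix ent ent' 1 c d' W * x W)))
    (hcond : (∑ W ∈ U.powerset.filter (fun W => ¬ ∃ r ∈ ent ∪ ent', r ∈ W), ν W * c W) * l0 *
      ((((∑ W ∈ U.powerset, ν W * chainMix ent ent' 0 c d W) * (∑ W ∈ U.powerset, ν W * chainMix ent ent' 1 c d W * x W) - (∑ W ∈ U.powerset, ν W * chainMix ent ent' 0 c d W * x W) * (∑ W ∈ U.powerset, ν W * chainMix ent ent' 1 c d W)) *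
          ((∑ W ∈ U.powerset, ν W * chainMix ent ent' 0 c d W) * (∑ W ∈ U.powerset, ν W * chainMix ent ent' 0 c d' W * y W) - (∑ W ∈ U.powerset, ν W * chainMix ent ent' 0 c d W * y W) * (∑ W ∈ U.powerset, ν W * chainMix ent ent' 0 c d' W))
        + ((∑ W ∈ U.powerset, ν W * chainMix ent ent' 0 c d W) * (∑ W ∈ U.powerset, ν W * chainMix ent ent' 1 c d W * y W) - (∑ W ∈ U.powerset, ν W * chainMix ent ent' 0 c d W * y W) * (∑ W ∈ U.powerset, ν W * chainMix ent ent' 1 c d W)) *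
          ((∑ W ∈ U.powerset, ν W * chainMix ent ent' 0 c d W) * (∑ W ∈ U.powerset, ν W * chainMix ent ent' 0 c d' W * x W) - (∑ W ∈ U.powerset, ν W * chainMix ent ent' 0 c d W * x W) * (∑ W ∈ U.powerset, ν W * chainMix ent ent' 0 c d' W)))) ≤
      (∑ W ∈ U.powerset, ν W * chainMix ent ent' 0 c d W) * ((∑ W ∈ U.powerset, ν W * chainMix ent ent' 0 c d W) * (((∑ W ∈ U.powerset, ν W * chainMix ent ent' 0 c d W) * l2 - (∑ W ∈ U.powerset, ν W * chainMix ent ent' 0 c d W * y W) * l0) * ((∑ W ∈ U.powerset.filter (fun W => ¬ ∃ r ∈ ent ∪ ent', r ∈ W), ν W * c W) * (∑ W ∈ U.powerset, ν W * chainMix ent ent' 1 c d' W * x W) - (∑ W ∈ U.powerset.filter (fun W => ¬ ∃ r ∈ ent ∪ ent', r ∈ W), ν W * c W * x W) * (∑ W ∈ U.powerset, ν W * chainMix ent ent' 1 c d' W)))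
        + ((∑ W ∈ U.powerset, ν W * chainMix ent ent' 0 c d W) * (∑ W ∈ U.powerset.filter (fun W => ¬ ∃ r ∈ ent ∪ ent', r ∈ W), ν W * c W * x W) - (∑ W ∈ U.powerset, ν W * chainMix ent ent' 0 c d W * x W) * (∑ W ∈ U.powerset.filter (fun W => ¬ ∃ r ∈ ent ∪ ent', r ∈ W), ν W * c W)) * l0 * ((∑ W ∈ U.powerset, ν W * chainMix ent ent' 0 c d W) * (∑ W ∈ U.powerset, ν W * chainMix ent ent' 1 c d' W * y W) - (∑ W ∈ U.powerset, ν W * chainMix ent ent' 0 c d W * y W) * (∑ W ∈ U.powerset, ν W * chainMix ent ent' 1 c d' W))))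
    :
    (((∑ W ∈ U.powerset, ν W * chainMix ent ent' 0 c d W) * (∑ W ∈ U.powerset, ν W * chainMix ent ent' 1 c d W * x W) - (∑ W ∈ U.powerset, ν W * chainMix ent ent' 0 c d W * x W) * (∑ W ∈ U.powerset, ν W * chainMix ent ent' 1 c d W)) *
          ((∑ W ∈ U.powerset, ν W * chainMix ent ent' 0 c d W) * (∑ W ∈ U.powerset, ν W * chainMix ent ent' 0 c d' W * y W) - (∑ W ∈ U.powerset, ν W * chainMix ent ent' 0 c d W * y W) * (∑ W ∈ U.powerset, ν W * chainMix ent ent' 0 c d' W))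
        + ((∑ W ∈ U.powerset, ν W * chainMix ent ent' 0 c d W) * (∑ W ∈ U.powerset, ν W * chainMix ent ent' 1 c d W * y W) - (∑ W ∈ U.powerset, ν W * chainMix ent ent' 0 c d W * y W) * (∑ W ∈ U.powerset, ν W * chainMix ent ent' 1 c d W)) *
          ((∑ W ∈ U.powerset, ν W * chainMix ent ent' 0 c d W) * (∑ W ∈ U.powerset, ν W * chainMix ent ent' 0 c d' W * x W) - (∑ W ∈ U.powerset, ν W * chainMix ent ent' 0 c d W * x W) * (∑ W ∈ U.powerset, ν W * chainMix ent ent' 0 c d' W))) ≤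
        (∑ W ∈ U.powerset, ν W * chainMix ent ent' 0 c d W) * ((∑ W ∈ U.powerset, ν W * chainMix ent ent' 0 c d W) * (∑ W ∈ U.powerset, ν W * chainMix ent ent' 0 c d W) * (∑ W ∈ U.powerset, ν W * chainMix ent ent' 1 c d' W * (x W * y W))
          - (∑ W ∈ U.powerset, ν W * chainMix ent ent' 0 c d W) * (∑ W ∈ U.powerset, ν W * chainMix ent ent' 0 c d W * y W) * (∑ W ∈ U.powerset, ν W * chainMix ent ent' 1 c d' W * x W)
          - (∑ W ∈ U.powerset, ν W * chainMix ent ent' 0 c d W) * (∑ W ∈ U.powerset, ν W * chainMix ent ent' 0 c d W * x W) * (∑ W ∈ U.powerset, ν W * chainMix ent ent' 1 c d' W * y W)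
          + (∑ W ∈ U.powerset, ν W * chainMix ent ent' 0 c d W * x W) * (∑ W ∈ U.powerset, ν W * chainMix ent ent' 0 c d W * y W) * (∑ W ∈ U.powerset, ν W * chainMix ent ent' 1 c d' W)) := by
  have e : (∑ W ∈ U.powerset, ν W * chainMix ent ent' 1 c d' W * (y W * x W)) =
      ∑ W ∈ U.powerset, ν W * chainMix ent ent' 1 c d' W * (x W * y W) :=
    Finset.sum_congr rfl fun W _ => by rw [mul_comm (y W)]
  rw [← e] at hC
  have h := chain_XA'_of_cake U ent ent' ν c d d' hν0 hc0 hd0 y x hmI l0 l2 hl0 hC (by linarith [hcond])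
  rw [e] at h
  linarith [h]

end CakeChain

end Summit.Ventures.PercRepro2.Coin
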